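import Mathlib
import Summits.MatrixMultiplication.Statement
import Summits.MatrixMultiplication.MatrixMultiplication.Theses.SemilatticeSTPP
import Summits.MatrixMultiplication.MatrixMultiplication.Theorems.SemilatticeSTPPThesisStubLocalDesignSound

/-!
# Crux `Thesis` (stmt-MatrixMultiplication-5969) — strategist line `Lines/localCapacity.lean`, route `SemilatticeSTPP`

LINE `localCapacity` (crux-strategist, 2026-08-17; lenses: TRANSFER-with-dictionary from CKSU 2005 Thm 33
"local strong USP ⇒ STPP family in `Cyc_ℓ^k`" + STRENGTHEN to a fixed-alphabet capacity statement).

The crux, verbatim (`…Theses.SemilatticeSTPP.Thesis` = X_M): for every `ε > 0` a finite commutative monoid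
with every element regular and a monoid-TPP family (iff-form) with `|M| < Σ_i (a_i b_i c_i)^((2+ε)/3)`.

THE LINE.  Hosts are POWERS `Cⁿ = (Fin n → C)` of a small Clifford base `C`; blocks are TENSOR PRODUCTS of
LETTERS: a letter `σ` is a tiny TPP block `(αg σ, βg σ, γg σ)` of shape `⟨ag σ, bg σ, cg σ⟩` inside `C`
itself; a block is a WORD `row i : Fin n → Fin k`; the family is TPP as soon as every ordered triple of words
not all equal has a KILLING coordinate — a coordinate whose three letters `(row i c, row j c, row l c)` can
never satisfy `α·β = γ` for any local values (strong local kill).  This is exactly the mechanism of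
Cohn–Kleinberg–Szegedy–Umans 2005 Thm 33 (tree: `Literature.Computability.AlgebraicComplexity.IsLocalStrongUSP`,
`CohnKleinbergSzegedyUmans2005_thm33`), whose base is the GROUP `Cyc_ℓ` with the three letters
`⟨ℓ−1,1,1⟩, ⟨1,ℓ−1,1⟩, ⟨1,1,ℓ−1⟩` and whose kill set is the six local-strong-USP patterns; here the base is
ANY finite commutative Clifford monoid — in particular a SEMILATTICE (e.g. `2^[2]`, letters = the recovering
pair `⟨1,2,1⟩`, `⟨2,1,2⟩`, `⟨4,1,1⟩`, `⟨1,1,4⟩`, constants) — and the kill relation is the semantic one.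

* `stub_capacityDesign` (XL, OPEN — the bet): for every `ε > 0` some base `C`, letter set and locally-killed
  word family whose VALUE `Σ_i Π_c (ag·bg·cg)(row i c)^((2+ε)/3)` beats `|C|ⁿ`.  STATUS (lead c2, 2026-08-17):
  the stub is EQUIVALENT to the crux (`Theorems/SemilatticeSTPPThesisCapacityReadback.lean`, p147938:
  `capacityDesign_of_thesis` = the `n = 1` read-back; with `Thesis_of` below); its ∃-body is PROVED for every `ε > 1`
  (`capacityDesign_of_one_lt`, one letter ⟨1,2,1⟩ in ℤ/2) and at `ε = 19/22` with genuine kills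
  (`Theorems/SemilatticeSTPPThesisUSPReadback.lean`, p150571: every local strong USP is a capacity design over
  `Multiplicative (ZMod ℓ)` — the six CKSU patterns are exactly the semantic kills of ⟨1,1,ℓ−1⟩,⟨ℓ−1,1,1⟩,⟨1,ℓ−1,1⟩ —
  instance `cyc11` over ℤ/17: `17^11 < 11·2^42`), and — lead c3, 2026-08-17 — at EVERY `ε ≥ 2/5`
  (`Theorems/SemilatticeSTPPThesisTwoFifths.lean`, p156795: the tree's sliced-CW₆ cyclic STPP design at exponent 4/5,
  `AutomaticPackingThesis.cyclicBeat_anyModulus_of_ge080`, transported by the abelian lift `thesisBodyAt_of_isSTPP`, p155785,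
  which also gives `thesis_of_cThesis : GroupTheoreticSTPP.CThesis → Thesis`, i.e. X_C ⇒ X_M).  OPEN: `0 < ε < 2/5` (`ε → 0`
  is the crux).  Group letters: a commutative GROUP base of bounded exponent is uniformly barred
  (`Theorems/SemilatticeSTPPThesisGroupHosts.lean`, p156310: normal form ⇒ STPP ⇒ BCCGNSU Thm B).  Semilattice letters: counting and
  garbage toolkit `Theorems/SemilatticeSTPPThesisCountingBounds.lean` (p157427), `…GarbageBounds.lean` (p157626); no VOLUME beat in
  any semilattice with `|M| ≤ 16` nor in `2^[4]` (SAT, `Cruxes/Thesis/Lines/localCapacity-rung2.md`).  First rung over the smallest semilattice base 2^[2] is NEGATIVE (no volume beat for n ≤ 3, complete;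
  garbage accounting `V − |M| = Exc − |nonΓ|` explains why; `Cruxes/Thesis/Lines/localCapacity-rung1.md`).  By the
  cap-set theorem and BCCGNSU Thm B every FIXED group base fails as `ε → 0`; by the strategist's Clifford matching
  dichotomy every fixed base with a non-trivial subgroup fails; small fixed semilattice bases fail by the B-role loss
  (`b ≤ width(↓g)`); what is left is LARGE semilattice bases (= cruxes 5970/5971) or bases growing with `ε`.
* `stub_localDesignSound` (L, CLOSED — landed p146519 `Theorems/SemilatticeSTPPThesisStubLocalDesignSound.lean`): the local design theorem — letters TPP + local kill ⇒ the word
  blocks form a monoid-TPP family (iff-form, indexed exactly like `matMulDirectSum`) in the host `Fin n → C`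
  with shapes `(Π_c ag(row i c), Π_c bg(row i c), Π_c cg(row i c))`.  CKSU Thm 33's half-page proof,
  verbatim in the monoid language (matched triple: coordinatewise letter-iff; unmatched: the killing
  coordinate), plus the bookkeeping `Fin (Π_c ag (row i c)) ≃ Π_c Fin (ag (row i c))`.

`Thesis_of : Thesis` is the real composition (host `Fin n → C` is a finite commutative monoid, regular
pointwise, of cardinality `|C|ⁿ`; `p := L`, `a i := Π_c ag (row i c)` …); `closed = false` only through the
two `stub_*`.

Disproof used: no `Disproof.lean` / `_false_without_` theorem exists for this crux (2026-08-17); honours the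
landed negative facts `Theorems/Thesis/Negative/SemilatticeSTPPVolumeFloor.lean` (volume floor: a witness of
`stub_capacityDesign` must have value between `|C|ⁿ` at exponent 2/3 and above — the USP instances do).
-/

set_option linter.dupNamespace false

namespace Summit.MatrixMultiplication.MatrixMultiplication.Cruxes.Thesis.LocalCapacity

open Summit.MatrixMultiplication.MatrixMultiplication.Theses.SemilatticeSTPP

/-- STUB 1 — CAPACITY DESIGNS (the open bet).  For every `ε > 0`: a finite commutative base monoid `C` with
every element regular; `k` letters, letter `σ` being a TPP block of shape `⟨ag σ, bg σ, cg σ⟩` inside `C`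
(same-letter iff); `L` words `row i : Fin n → Fin k` such that every ordered triple of words not all equal has
a coordinate whose letters KILL (no local values make `α·β = γ`); and value beating the host:
`|C|^n < Σ_i (Π_c ag · Π_c bg · Π_c cg)^((2+ε)/3)`. -/
theorem stub_capacityDesign :
    ∀ ε : ℝ, 0 < ε → ∃ (C : Type) (_ : CommMonoid C) (_ : Fintype C),
      (∀ x : C, ∃ y : C, x * y * x = x) ∧
      ∃ (k : ℕ) (ag bg cg : Fin k → ℕ)
        (αg : (Σ σ : Fin k, Fin (ag σ) × Fin (bg σ)) → C)
        (βg : (Σ σ : Fin k, Fin (bg σ) × Fin (cg σ)) → C)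
        (γg : (Σ σ : Fin k, Fin (ag σ) × Fin (cg σ)) → C)
        (L n : ℕ) (row : Fin L → Fin n → Fin k),
        (∀ (σ : Fin k) (s s' : Fin (ag σ)) (t t' : Fin (bg σ)) (u u' : Fin (cg σ)),
            αg ⟨σ, (s, t)⟩ * βg ⟨σ, (t', u)⟩ = γg ⟨σ, (s', u')⟩ ↔ (s' = s ∧ t = t' ∧ u' = u)) ∧
        (∀ i j l : Fin L, (i ≠ j ∨ j ≠ l) → ∃ c : Fin n,
            ∀ (s : Fin (ag (row i c))) (t : Fin (bg (row i c))) (t' : Fin (bg (row j c)))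
              (u : Fin (cg (row j c))) (s' : Fin (ag (row l c))) (u' : Fin (cg (row l c))),
              αg ⟨row i c, (s, t)⟩ * βg ⟨row j c, (t', u)⟩ ≠ γg ⟨row l c, (s', u')⟩) ∧
        (Fintype.card C : ℝ) ^ n <
          ∑ i : Fin L, (((∏ c, ag (row i c)) * (∏ c, bg (row i c)) * (∏ c, cg (row i c)) : ℕ) : ℝ) ^
            ((2 + ε) / 3) := by
  sorry

/-- STUB 2 — THE LOCAL DESIGN THEOREM (soundness; provable now, CKSU 2005 Thm 33 in the monoid language).
Letters that are TPP blocks inside `C` and a locally-killed word family give a monoid-TPP family (iff-form,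
`matMulDirectSum` indexing) in the power host `Fin n → C`, block `i` having shape
`⟨Π_c ag(row i c), Π_c bg(row i c), Π_c cg(row i c)⟩` (the word block = tensor product of its letters). -/
theorem stub_localDesignSound :
    ∀ (C : Type) [CommMonoid C] (k : ℕ) (ag bg cg : Fin k → ℕ)
      (αg : (Σ σ : Fin k, Fin (ag σ) × Fin (bg σ)) → C)
      (βg : (Σ σ : Fin k, Fin (bg σ) × Fin (cg σ)) → C)
      (γg : (Σ σ : Fin k, Fin (ag σ) × Fin (cg σ)) → C)
      (L n : ℕ) (row : Fin L → Fin n → Fin k),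
      (∀ (σ : Fin k) (s s' : Fin (ag σ)) (t t' : Fin (bg σ)) (u u' : Fin (cg σ)),
          αg ⟨σ, (s, t)⟩ * βg ⟨σ, (t', u)⟩ = γg ⟨σ, (s', u')⟩ ↔ (s' = s ∧ t = t' ∧ u' = u)) →
      (∀ i j l : Fin L, (i ≠ j ∨ j ≠ l) → ∃ c : Fin n,
          ∀ (s : Fin (ag (row i c))) (t : Fin (bg (row i c))) (t' : Fin (bg (row j c)))
            (u : Fin (cg (row j c))) (s' : Fin (ag (row l c))) (u' : Fin (cg (row l c))),
            αg ⟨row i c, (s, t)⟩ * βg ⟨row j c, (t', u)⟩ ≠ γg ⟨row l c, (s', u')⟩) →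
      ∃ (α : (Σ i : Fin L, Fin (∏ c, ag (row i c)) × Fin (∏ c, bg (row i c))) → (Fin n → C))
        (β : (Σ i : Fin L, Fin (∏ c, bg (row i c)) × Fin (∏ c, cg (row i c))) → (Fin n → C))
        (γ : (Σ i : Fin L, Fin (∏ c, ag (row i c)) × Fin (∏ c, cg (row i c))) → (Fin n → C)),
        ∀ x y z, α x * β y = γ z ↔
          (z.1 = x.1 ∧ x.1 = y.1 ∧ (z.2.1 : ℕ) = x.2.1 ∧ (x.2.2 : ℕ) = y.2.1 ∧ (z.2.2 : ℕ) = y.2.2) :=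
  -- CLOSED (wave 1, p146519): `Theorems/SemilatticeSTPPThesisStubLocalDesignSound.lean`
  Summit.MatrixMultiplication.MatrixMultiplication.Theorems.SemilatticeSTPPThesis.stub_localDesignSound

/-- **THE SKELETON THEOREM.** `SemilatticeSTPP.Thesis` (stmt-MatrixMultiplication-5969) BY NAME from the two
declared stubs: take the capacity design of `stub_capacityDesign ε`, realise it by `stub_localDesignSound` in
the power host `M := Fin n → C` (a finite commutative monoid, every element regular pointwise,
`|M| = |C|^n`), with `p := L` blocks of shapes `a i := Π_c ag (row i c)` etc.  Real proof; the only `sorry`s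
of the file are the two stubs. -/
theorem Thesis_of : Thesis := by
  intro ε hε
  obtain ⟨C, instC, instF, hreg, k, ag, bg, cg, αg, βg, γg, L, n, row, hletter, hkill, hval⟩ :=
    stub_capacityDesign ε hε
  obtain ⟨α, β, γ, htpp⟩ := stub_localDesignSound C k ag bg cg αg βg γg L n row hletter hkill
  refine ⟨(Fin n → C), inferInstance, inferInstance, ?_, L,
    (fun i => ∏ c, ag (row i c)), (fun i => ∏ c, bg (row i c)), (fun i => ∏ c, cg (row i c)),
    α, β, γ, htpp, ?_⟩
  · intro x
    choose g hg using hreg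
    exact ⟨fun c => g (x c), funext fun c => by simp [Pi.mul_apply, hg]⟩
  · have hcard : (Fintype.card (Fin n → C) : ℝ) = (Fintype.card C : ℝ) ^ n := by
      rw [Fintype.card_fun, Fintype.card_fin]; push_cast; ring
    rw [hcard]
    exact hval

end Summit.MatrixMultiplication.MatrixMultiplication.Cruxes.Thesis.LocalCapacity
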